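import Mathlib
import Summits.ValiantsHypothesis.ValiantsHypothesis.Theses.BarrierLever
import Literature.Computability.AlgebraicComplexity.ArithCircuitProofs
import Literature.Computability.AlgebraicComplexity.IMMInVPProofs
import Literature.Computability.AlgebraicComplexity.BurgisserBooleanParts

/-!
# Crux `BarrierLever.DefinableEquations` (stmt-8745) — in the lever's world the BOOLEAN FAN-IN of
# every witness is load-bearing: `q > c · log₂ N` for every `c` (val-np-p5 g25)

A `DefinableEquations` / `SingleSizeEquations` witness at `(n, b, a)` is a datum
`H ∈ ℂ[degLEMonomials n ⊕ Fin q]` with `L(H), deg H ≤ N^a` (`N = C(2n,n)`) whose Boolean sum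
`E = Σ_{e ∈ {0,1}^q} H(c, e)` is nonzero and vanishes on `coeff(SmallCircuits ℂ n b)`.  Since
`L(E) ≤ 2^q (L(H) + 1)` (`complexity_boolSum_le`, the tree's lemma re-proved for an arbitrary finite
coefficient index), a witness with FEW Boolean variables, `2^q ≤ N^c`, is itself a level-`(a+c+1)`
distinguisher with `q = 0` (`boolSum_mem_distinguishers`).  Hence, under the route's OTHER crux
`SuccinctHittingSetsForVP` (stmt-14610, FSV Question 6: `∀ a' ∃ b₀ …` the coefficient vectors of
`SmallCircuits ℂ n b₀` hit every nonzero level-`a'` distinguisher), every witness against size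
`n^b`, `b ≥ b₀(a+c+1)`, has `N^c < 2^q` (`booleanFanIn_lower_bound`; log form
`c · log₂ N < q`, `booleanFanIn_lower_bound_log`): in the lever's world `LeverThesis = SHS ∧ DefEq`
the exponential sum of a witness ranges over `N^{ω(1)}` terms — super-polynomially many in `N` —
for all large size exponents (`leverThesis_booleanFanIn`); in particular no `q = 0` (VP(N)) witness
and no witness with `O(log N)` Boolean variables survives there.  This complements the cell's rank
template walls (val-np-p5 g11: affine rank methods are `q = 0`, hence dead under 14610) with the
quantitative statement for arbitrary witnesses.  Pure bookkeeping over the tree's definitions; the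
cruxes stay OPEN; nothing here bears on `VP ≠ VNP`.  No definitions, no named facts.
Refs: Bürgisser 2000 Def. 2.5 / §2.1 (Boolean sums); Forbes–Shpilka–Volk 2018 Def. 1.1, Question 6.
-/

set_option linter.dupNamespace false

noncomputable section

namespace Summit.ValiantsHypothesis.ValiantsHypothesis.Theorems.BarrierLeverDefinableEquations

open MvPolynomial
open Literature.Computability.AlgebraicComplexity Literature.Barriers.ValiantsHypothesis
open Summit.ValiantsHypothesis.ValiantsHypothesis.Theses.BarrierLever
open scoped BigOperators

namespace BooleanFanIn

/-! ## 1. The cost of a Boolean sum -/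

/-- **A Boolean sum of length `q` costs at most `2^q (L(H) + 1)`** — each of the `2^q` summands
`H(c, e)` is `H` with the constants `0, 1` substituted (`complexity_aeval_le`), and adding `2^q`
polynomials costs `2^q` gates (`complexity_finset_sum_le`).  (The tree's
`NaturalProofsSeparateVNP.complexity_boolSum_le`, re-proved for an arbitrary finite coefficient
index type.) [cite: Burgisser2000, Def. 2.5 and §2.1] -/
theorem complexity_boolSum_le {ι : Type*} [Fintype ι] [DecidableEq ι] {q : ℕ}
    (H : MvPolynomial (ι ⊕ Fin q) ℂ) :
    complexity (boolSum H) ≤ 2 ^ q * (complexity H + 1) := by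
  classical
  unfold boolSum
  refine (complexity_finset_sum_le _ _).trans ?_
  have hterm : ∀ e : Fin q → Bool,
      complexity (aeval (Sum.elim X fun j => if e j then (1 : MvPolynomial ι ℂ) else 0) H) ≤
        complexity H := by
    intro e
    refine (complexity_aeval_le H _).trans (le_of_eq ?_)
    rw [Finset.sum_eq_zero fun i _ => ?_, add_zero]
    rcases i with i | j
    · simp only [Sum.elim_inl]
      exact complexity_X_holds i
    · simp only [Sum.elim_inr]
      split_ifs
      · rw [← C_1]; exact complexity_C_holds (1 : ℂ)
      · rw [← C_0]; exact complexity_C_holds (0 : ℂ)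
  calc ∑ e : Fin q → Bool,
        complexity (aeval (Sum.elim X fun j => if e j then (1 : MvPolynomial ι ℂ) else 0) H) +
        (Finset.univ : Finset (Fin q → Bool)).card
      ≤ ∑ _e : Fin q → Bool, complexity H + (Finset.univ : Finset (Fin q → Bool)).card :=
        Nat.add_le_add_right (Finset.sum_le_sum fun e _ => hterm e) _
    _ = 2 ^ q * (complexity H + 1) := by
        rw [Finset.sum_const, Finset.card_univ, Fintype.card_fun, Fintype.card_bool,
          Fintype.card_fin, smul_eq_mul]
        ring

/-- `2 ≤ C(2n, n)` for `n ≥ 1` (Mathlib's `Nat.two_le_centralBinom`). [folklore] -/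
theorem two_le_centralBinom {n : ℕ} (hn : 1 ≤ n) : 2 ≤ Nat.choose (2 * n) n := by
  rw [← Nat.centralBinom_eq_two_mul_choose]
  exact Nat.two_le_centralBinom n hn

/-! ## 2. Few Boolean variables ⇒ the witness is a `q = 0` distinguisher one level up -/

/-- **A short Boolean sum is a plain distinguisher.**  If `L(H), deg H ≤ N^a` and `2^q ≤ N^c`
(`N = C(2n,n)`, `n ≥ 1`), then `boolSum H ∈ Distinguishers ℂ n (a + c + 1)`:
`L(boolSum H) ≤ 2^q (N^a + 1) ≤ N^c (N^a + 1) ≤ N^(a+c+1)` and `deg (boolSum H) ≤ deg H`.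
[cite: Burgisser2000, Def. 2.5; ForbesShpilkaVolk2018, Cor. 5] -/
theorem boolSum_mem_distinguishers {n a c q : ℕ} (hn : 1 ≤ n)
    (H : MvPolynomial (↥(degLEMonomials n) ⊕ Fin q) ℂ)
    (hH : complexity H ≤ (Nat.choose (2 * n) n) ^ a) (hdeg : H.totalDegree ≤ (Nat.choose (2 * n) n) ^ a)
    (hq : 2 ^ q ≤ (Nat.choose (2 * n) n) ^ c) :
    boolSum H ∈ Distinguishers ℂ n (a + c + 1) := by
  classical
  set N := Nat.choose (2 * n) n with hN
  have hN2 : 2 ≤ N := two_le_centralBinom hn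
  refine ⟨?_, ?_⟩
  · calc complexity (boolSum H) ≤ 2 ^ q * (complexity H + 1) := complexity_boolSum_le H
      _ ≤ N ^ c * (N ^ a + 1) := Nat.mul_le_mul hq (Nat.add_le_add_right hH 1)
      _ = N ^ (a + c) + N ^ c := by ring
      _ ≤ N ^ (a + c) + N ^ (a + c) :=
          Nat.add_le_add_left (Nat.pow_le_pow_right (by omega) (by omega)) _
      _ = 2 * N ^ (a + c) := by ring
      _ ≤ N * N ^ (a + c) := Nat.mul_le_mul_right _ hN2
      _ = N ^ (a + c + 1) := by ring
  · calc (boolSum H).totalDegree ≤ H.totalDegree :=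
          Literature.Computability.AlgebraicComplexity.totalDegree_boolSum_le H
      _ ≤ N ^ a := hdeg
      _ ≤ N ^ (a + c + 1) := Nat.pow_le_pow_right (by omega) (by omega)

/-! ## 3. Under `SuccinctHittingSetsForVP` every witness has `N^c < 2^q` -/

/-- **Boolean fan-in lower bound in the world of crux 14610.**  Assume `SuccinctHittingSetsForVP`
(FSV Question 6 "yes": `∀ a' ∃ b₀ n₀ ∀ n ≥ n₀`, `coeff(SmallCircuits ℂ n b₀)` hits every nonzero
level-`a'` distinguisher).  Then for all levels `a` and all `c` there are `b₀, n₀` such that for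
every `b ≥ b₀`, `n ≥ n₀`: any Boolean-sum datum `H` of level `a` (`L(H), deg H ≤ N^a`) whose
Boolean sum is NONZERO and VANISHES on `coeff(SmallCircuits ℂ n b)` uses more than `c · log₂ N`
Boolean variables: `N^c < 2^q`.  (Otherwise `boolSum H` is a level-`(a+c+1)` distinguisher with
`q = 0`, hit by `SmallCircuits ℂ n b₀ ⊆ SmallCircuits ℂ n b`.)
[cite: ForbesShpilkaVolk2018, Question 6 and Thm. 4] -/
theorem booleanFanIn_lower_bound (hS : SuccinctHittingSetsForVP) (a c : ℕ) :
    ∃ b₀ n₀ : ℕ, ∀ b : ℕ, b₀ ≤ b → ∀ n : ℕ, n₀ ≤ n →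
      ∀ (q : ℕ) (H : MvPolynomial (↥(degLEMonomials n) ⊕ Fin q) ℂ),
        complexity H ≤ (Nat.choose (2 * n) n) ^ a → H.totalDegree ≤ (Nat.choose (2 * n) n) ^ a →
        boolSum H ≠ 0 →
        (∀ f ∈ SmallCircuits ℂ n b, eval (coeffVector (degLEMonomials n) f) (boolSum H) = 0) →
        (Nat.choose (2 * n) n) ^ c < 2 ^ q := by
  obtain ⟨b₀, n₁, hhit⟩ := hS (a + c + 1)
  refine ⟨b₀, max n₁ 1, fun b hb n hn q H hH hdeg hne hvan => ?_⟩
  have hn1 : 1 ≤ n := le_trans (le_max_right _ _) hn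
  by_contra hq
  rw [not_lt] at hq
  have hmem : boolSum H ∈ Distinguishers ℂ n (a + c + 1) := boolSum_mem_distinguishers hn1 H hH hdeg hq
  obtain ⟨f, hf, hfne⟩ := hhit n (le_trans (le_max_left _ _) hn) (boolSum H) hmem hne
  exact hfne (hvan f (smallCircuits_mono ℂ hb hn1 hf))

/-- **Log form**: under `SuccinctHittingSetsForVP`, witnesses against size `n^b`, `b ≥ b₀(a,c)`,
have `c · log₂ N < q`. [cite: ForbesShpilkaVolk2018, Question 6] -/
theorem booleanFanIn_lower_bound_log (hS : SuccinctHittingSetsForVP) (a c : ℕ) :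
    ∃ b₀ n₀ : ℕ, ∀ b : ℕ, b₀ ≤ b → ∀ n : ℕ, n₀ ≤ n →
      ∀ (q : ℕ) (H : MvPolynomial (↥(degLEMonomials n) ⊕ Fin q) ℂ),
        complexity H ≤ (Nat.choose (2 * n) n) ^ a → H.totalDegree ≤ (Nat.choose (2 * n) n) ^ a →
        boolSum H ≠ 0 →
        (∀ f ∈ SmallCircuits ℂ n b, eval (coeffVector (degLEMonomials n) f) (boolSum H) = 0) →
        c * Nat.log 2 (Nat.choose (2 * n) n) < q := by
  obtain ⟨b₀, n₀, h⟩ := booleanFanIn_lower_bound hS a c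
  refine ⟨b₀, n₀, fun b hb n hn q H hH hdeg hne hvan => ?_⟩
  have hlt := h b hb n hn q H hH hdeg hne hvan
  -- `2^(c log₂ N) ≤ N^c < 2^q`
  have hN0 : Nat.choose (2 * n) n ≠ 0 := (Nat.choose_pos (show n ≤ 2 * n by omega)).ne'
  have hle : 2 ^ (c * Nat.log 2 (Nat.choose (2 * n) n)) ≤ (Nat.choose (2 * n) n) ^ c := by
    rw [mul_comm, pow_mul]
    exact Nat.pow_le_pow_left (Nat.pow_log_le_self 2 hN0) c
  exact (Nat.pow_lt_pow_iff_right (by norm_num : 1 < 2)).mp (lt_of_le_of_lt hle hlt)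

/-- **`q = 0` is excluded** (the case `c = 0`): under `SuccinctHittingSetsForVP` no witness
against size `n^b`, `b ≥ b₀(a)`, is a plain level-`a` distinguisher — every witness has `q ≥ 1`.
[cite: ForbesShpilkaVolk2018, Question 6] -/
theorem one_le_booleanFanIn (hS : SuccinctHittingSetsForVP) (a : ℕ) :
    ∃ b₀ n₀ : ℕ, ∀ b : ℕ, b₀ ≤ b → ∀ n : ℕ, n₀ ≤ n →
      ∀ (q : ℕ) (H : MvPolynomial (↥(degLEMonomials n) ⊕ Fin q) ℂ),
        complexity H ≤ (Nat.choose (2 * n) n) ^ a → H.totalDegree ≤ (Nat.choose (2 * n) n) ^ a →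
        boolSum H ≠ 0 →
        (∀ f ∈ SmallCircuits ℂ n b, eval (coeffVector (degLEMonomials n) f) (boolSum H) = 0) →
        1 ≤ q := by
  obtain ⟨b₀, n₀, h⟩ := booleanFanIn_lower_bound hS a 0
  refine ⟨b₀, n₀, fun b hb n hn q H hH hdeg hne hvan => ?_⟩
  have hlt := h b hb n hn q H hH hdeg hne hvan
  rw [pow_zero] at hlt
  by_contra hq
  have : q = 0 := by omega
  subst this
  simp at hlt

/-! ## 4. The lever's world -/

/-- **In the lever's world the exponential sum is load-bearing.**  Under the route's target
`LeverThesis = SuccinctHittingSetsForVP ∧ DefinableEquations`: for every level `a` and every `c`,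
beyond some size exponent `b₀` and some `n₀`, EVERY Boolean-sum equation of level `a` against
`SmallCircuits ℂ n b` has `N^c < 2^q` — its exponential sum ranges over super-polynomially many
(in `N`) terms.  In particular the `DefinableEquations` witnesses that the lever consumes are of
genuinely `VNP ∖ VP` type at scale `N`. [cite: ForbesShpilkaVolk2018, Question 6 and Def. 1] -/
theorem leverThesis_booleanFanIn (hX : LeverThesis) (a c : ℕ) :
    ∃ b₀ n₀ : ℕ, ∀ b : ℕ, b₀ ≤ b → ∀ n : ℕ, n₀ ≤ n →
      ∀ (q : ℕ) (H : MvPolynomial (↥(degLEMonomials n) ⊕ Fin q) ℂ),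
        complexity H ≤ (Nat.choose (2 * n) n) ^ a → H.totalDegree ≤ (Nat.choose (2 * n) n) ^ a →
        boolSum H ≠ 0 →
        (∀ f ∈ SmallCircuits ℂ n b, eval (coeffVector (degLEMonomials n) f) (boolSum H) = 0) →
        (Nat.choose (2 * n) n) ^ c < 2 ^ q :=
  booleanFanIn_lower_bound hX.1 a c

end BooleanFanIn

end Summit.ValiantsHypothesis.ValiantsHypothesis.Theorems.BarrierLeverDefinableEquations
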